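import Literature.AnabelianGeometry.SemiGraphs.IwahoriMetabelianLeaves
import Literature.GroupTheory.CompactGroupIntersections
import HarnessLib

/-!
# ASYMPTOTIC MALNORMALITY of the torus `B_n` in the metabelian leaf `Leaf n = ℤ_p ⋊ ⟨1 + p^{n+1}⟩‾`

Mochizuki, *Semi-graphs of anabelioids*, Publ. RIMS **42** (2006), Def. 2.4 (iv) p. 26 (estranged branch
groups), Remark 2.2.1 pp. 23–24 (uniform choices over a tower, compactness) [cite: MochizukiSemiAnbd2006, Def 2.4 p.25-26];
the group theory is elementary in the tree's concrete `Iw p = ℤ_p ⋊ (1 + pℤ_p)` (abc-iut-w5-d236,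
`WitnessIwahoriGroup.lean`) and its leaves (abc-iut-L3-t8 gen 6, `IwahoriMetabelianLeaves.lean`:
`range_lowHom_inf_conj_eq_bot`, malnormality of `B_n = lowHom n (ℤ_p)`), cf. Ribes–Zalesskii, *Profinite Groups*,
§4.1 [cite: RibesZalesskii2010, §4.1].

PROOF-ONLY tool file (abc-iut cell, layer L3, row «EXOTIC-ISOLATION@STAR», file F3a, seat abc-iut-L3-t8 gen 9; no
definition, no named fact).  Malnormality of `B_n ≤ Leaf n` says: `F·s(κ₁)·F⁻¹ = s(κ₂)` with `κ₁ ≠ 0` forces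
`F ∈ B_n` (`mem_range_lowHom_of_conj_eq`).  Its ASYMPTOTIC form along a decreasing family of open
subgroups `L i ≤ Leaf n` with trivial intersection (the level kernels of a faithful tempered tower):

* `exists_level_forall_conj_mem_imp` — for every precision `p^{e₀}` and every `j` there is a level `I` such that,
  for all `i ≥ I`: if `F·s(κ₁)·F⁻¹ ∈ s(κ₂)·L i` with `κ₁ ≢ 0 (mod p^{e₀})`, then `F ∈ B_n · L j`
  (compactness of `Leaf n × ℤ_p × ℤ_p`: `exists_mem_forall_of_antitone`).

Consumer: the leaf-local collapse of `MetabelianLeafStarPureTypeAnchored.lean`.  Pure group theory/topology;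
nothing here bears on [IUTchIII] Cor. 3.12; no side taken.
-/

noncomputable section

open Topology Multiplicative

namespace Literature.AnabelianGeometry.SemiGraphs

open IwahoriWitness
open Literature.GroupTheory.CompactGroupIntersections (exists_mem_forall_of_antitone)
open Literature.NumberTheory.GaloisRepresentations (OneUnits.continuous_toZModPow)

variable {p : ℕ} [hp : Fact p.Prime]

namespace Iw

/-! ### Malnormality in conjugation form -/

/-- **Malnormality of `B_n` in conjugation form**: if `F·s(κ₁)·F⁻¹ = s(κ₂)` with `κ₁ ≠ 0` (`s = lowHom n`), then
`F ∈ B_n`. [cite: MochizukiSemiAnbd2006, Def 2.4(iv) p.26] -/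
theorem mem_range_lowHom_of_conj_eq (n : ℕ) (F : Leaf (p := p) n) (κ₁ κ₂ : Multiplicative ℤ_[p])
    (hκ₁ : κ₁ ≠ 1) (h : F * lowHom n κ₁ * F⁻¹ = lowHom n κ₂) : F ∈ (lowHom (p := p) n).toMonoidHom.range := by
  by_contra hF
  have hbot := range_lowHom_inf_conj_eq_bot F hF
  have hmem : (lowHom (p := p) n κ₂ : Leaf (p := p) n) ∈ (lowHom (p := p) n).toMonoidHom.range ⊓
      ((lowHom (p := p) n).toMonoidHom.range.map (MulAut.conj F).toMonoidHom) :=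
    ⟨⟨κ₂, rfl⟩, ⟨lowHom n κ₁, ⟨κ₁, rfl⟩, by rw [← h]; rfl⟩⟩
  rw [hbot, Subgroup.mem_bot] at hmem
  have h1 : F * lowHom n κ₁ * F⁻¹ = 1 := h.trans hmem
  rw [mul_inv_eq_one, mul_eq_left] at h1
  exact hκ₁ (lowHom_injective n (h1.trans (map_one _).symm))

/-- An element of `ℤ_p` with non-zero reduction modulo `p^{e₀}` is non-zero, i.e. `≠ 1` in `Multiplicative ℤ_p`.
[cite: RibesZalesskii2010, §4.1] -/
theorem ne_one_of_toZModPow_ne_zero {e₀ : ℕ} {κ : Multiplicative ℤ_[p]} (h : PadicInt.toZModPow e₀ κ.toAdd ≠ 0) :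
    κ ≠ 1 := by
  rintro rfl
  exact h (by rw [toAdd_one, map_zero])

/-! ### Asymptotic malnormality along a faithful tower of open subgroups -/

/-- **ASYMPTOTIC MALNORMALITY of `B_n ≤ Leaf n`.**  Let `L : ℕ → Subgroup (Leaf n)` be a decreasing family of
open subgroups with trivial intersection.  For every precision `e₀` and every `j` there is `I` such that
for all `i ≥ I`, all `F ∈ Leaf n` and all `κ₁, κ₂ ∈ ℤ_p` with `κ₁ ≢ 0 (mod p^{e₀})`:
`F·s(κ₁)·F⁻¹ ∈ s(κ₂)·L i` implies `F ∈ B_n·L j` (`s = lowHom n`).  Proof: the bad triples `(F, κ₁, κ₂)` at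
level `i` form a decreasing family of closed subsets of the compact `Leaf n × ℤ_p × ℤ_p`; a common point would
satisfy `F·s(κ₁)·F⁻¹ = s(κ₂)` with `κ₁ ≠ 0`, so `F ∈ B_n` by malnormality — but `F ∉ B_n·L j`.
[cite: MochizukiSemiAnbd2006, Rmk 2.2.1 p.23] -/
theorem exists_level_forall_conj_mem_imp (n : ℕ) (L : ℕ → Subgroup (Leaf (p := p) n))
    (hLopen : ∀ i, IsOpen (L i : Set (Leaf (p := p) n)))
    (hLanti : ∀ ⦃i i' : ℕ⦄, i ≤ i' → L i' ≤ L i) (hLinf : ∀ x : Leaf (p := p) n, (∀ i, x ∈ L i) → x = 1)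
    (e₀ j : ℕ) :
    ∃ I : ℕ, ∀ i, I ≤ i → ∀ (F : Leaf (p := p) n) (κ₁ κ₂ : Multiplicative ℤ_[p]),
      PadicInt.toZModPow e₀ κ₁.toAdd ≠ 0 → (lowHom n κ₂)⁻¹ * (F * lowHom n κ₁ * F⁻¹) ∈ L i →
        ∃ t : Multiplicative ℤ_[p], (lowHom n t)⁻¹ * F ∈ L j := by
  classical
  -- the bad sets
  let C : ℕ → Set (Leaf (p := p) n × Multiplicative ℤ_[p] × Multiplicative ℤ_[p]) := fun i =>
    {x | PadicInt.toZModPow e₀ x.2.1.toAdd ≠ 0 ∧ (lowHom n x.2.2)⁻¹ * (x.1 * lowHom n x.2.1 * x.1⁻¹) ∈ L i ∧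
      ∀ t : Multiplicative ℤ_[p], (lowHom n t)⁻¹ * x.1 ∉ L j}
  by_contra hcon
  push Not at hcon
  -- every bad set is non-empty (the family is decreasing)
  have hanti : ∀ ⦃i i' : ℕ⦄, i ≤ i' → C i' ⊆ C i := fun i i' h x hx => ⟨hx.1, hLanti h hx.2.1, hx.2.2⟩
  have hne : ∀ i, (C i).Nonempty := by
    intro i
    obtain ⟨i', hii', F, κ₁, κ₂, h1, h2, h3⟩ := hcon i
    exact ⟨⟨F, κ₁, κ₂⟩, hanti hii' ⟨h1, h2, h3⟩⟩
  -- every bad set is closed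
  have hcont : Continuous fun x : Leaf (p := p) n × Multiplicative ℤ_[p] × Multiplicative ℤ_[p] =>
      (lowHom n x.2.2)⁻¹ * (x.1 * lowHom n x.2.1 * x.1⁻¹) :=
    ((lowHom (p := p) n).continuous.comp (continuous_snd.comp continuous_snd)).inv.mul
      ((continuous_fst.mul ((lowHom (p := p) n).continuous.comp (continuous_fst.comp continuous_snd))).mul
        continuous_fst.inv)
  have hclosed : ∀ i, IsClosed (C i) := by
    intro i
    change IsClosed {x : Leaf (p := p) n × Multiplicative ℤ_[p] × Multiplicative ℤ_[p] |
      PadicInt.toZModPow e₀ x.2.1.toAdd ≠ 0 ∧ (lowHom n x.2.2)⁻¹ * (x.1 * lowHom n x.2.1 * x.1⁻¹) ∈ L i ∧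
        ∀ t : Multiplicative ℤ_[p], (lowHom n t)⁻¹ * x.1 ∉ L j}
    rw [Set.setOf_and, Set.setOf_and]
    refine IsClosed.inter ?_ (IsClosed.inter ?_ ?_)
    · -- `κ₁ ≢ 0 (mod p^{e₀})`
      have hc : Continuous fun x : Leaf (p := p) n × Multiplicative ℤ_[p] × Multiplicative ℤ_[p] =>
          PadicInt.toZModPow e₀ x.2.1.toAdd :=
        (OneUnits.continuous_toZModPow p e₀).comp (continuous_toAdd.comp (continuous_fst.comp continuous_snd))
      exact (isClosed_discrete ({0}ᶜ : Set (ZMod (p ^ e₀)))).preimage hc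
    · -- the conjugation condition: `L i` is open, hence closed
      exact ((L i).isClosed_of_isOpen (hLopen i)).preimage hcont
    · -- `F ∉ B_n · L j`: the complement of an open set
      have hopen : IsOpen {F : Leaf (p := p) n | ∃ t : Multiplicative ℤ_[p], (lowHom n t)⁻¹ * F ∈ L j} := by
        have heq : {F : Leaf (p := p) n | ∃ t : Multiplicative ℤ_[p], (lowHom n t)⁻¹ * F ∈ L j} =
            ⋃ t : Multiplicative ℤ_[p], (fun F => (lowHom n t)⁻¹ * F) ⁻¹' (L j : Set (Leaf (p := p) n)) := by
          ext F; simp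
        rw [heq]
        exact isOpen_iUnion fun t => (hLopen j).preimage (continuous_const.mul continuous_id)
      have h2 : {x : Leaf (p := p) n × Multiplicative ℤ_[p] × Multiplicative ℤ_[p] |
          ∀ t : Multiplicative ℤ_[p], (lowHom n t)⁻¹ * x.1 ∉ L j} =
          Prod.fst ⁻¹' {F : Leaf (p := p) n | ∃ t : Multiplicative ℤ_[p], (lowHom n t)⁻¹ * F ∈ L j}ᶜ := by
        ext x; simp
      rw [h2]
      exact (hopen.isClosed_compl).preimage continuous_fst
  -- a common bad triple
  obtain ⟨⟨F, κ₁, κ₂⟩, hF⟩ := exists_mem_forall_of_antitone C hanti hne hclosed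
  have h1 : PadicInt.toZModPow e₀ κ₁.toAdd ≠ 0 := (hF 0).1
  have h3 : ∀ t : Multiplicative ℤ_[p], (lowHom n t)⁻¹ * F ∉ L j := (hF 0).2.2
  have h2 : (lowHom n κ₂)⁻¹ * (F * lowHom n κ₁ * F⁻¹) = 1 := hLinf _ fun i => (hF i).2.1
  rw [inv_mul_eq_one] at h2
  obtain ⟨t, ht⟩ := mem_range_lowHom_of_conj_eq n F κ₁ κ₂ (ne_one_of_toZModPow_ne_zero h1) h2.symm
  refine h3 t ?_
  have ht' : lowHom n t = F := ht
  rw [ht', inv_mul_cancel]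
  exact (L j).one_mem

end Iw

end Literature.AnabelianGeometry.SemiGraphs

end
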